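import Summits.CriticalPhenomena.SAWScalingLimit.Theorems.SAWDevelopingMapObservableToSLETypeLadderCarvedReductionSqueezeOuter
import Summits.CriticalPhenomena.SAWScalingLimit.Theorems.SAWDevelopingMapObservableToSLETypeLadderCarvedReductionSqueezeReachTransfer
import Summits.CriticalPhenomena.SAWScalingLimit.Theorems.SAWDevelopingMapObservableToSLETypeLadderCarvedReductionSqueezeFrameDatum
import Summits.CriticalPhenomena.SAWScalingLimit.Theorems.SAWDevelopingMapObservableToSLETypeLadderCarvedReductionSqueezeInnerFacts
import Summits.CriticalPhenomena.SAWScalingLimit.Theorems.SAWDevelopingMapObservableToSLETypeLadderCarvedReductionSqueezeWalkOffZones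
import Summits.CriticalPhenomena.SAWScalingLimit.Theorems.SAWDefectDecoherenceObservableToSLERCarvedReductionSqueezeInnerApproximant
import HarnessLib

/-!
# The final pair `(E_{n₀}, M')` and its clauses (piece (T-A′₂F final-A) of stub T-A′₂F
# `stub_carvedReduction_squeezeGeometry_domainsCoreF`)

Crux `SAWDevelopingMap.ObservableToSLE` (stmt-CriticalPhenomena-10472), line `six-class-type-ladder`,
stub T-A′₂F `stub_carvedReduction_squeezeGeometry_domainsCoreF`.  Landing target:
`Summits/CriticalPhenomena/SAWScalingLimit/Theorems/SAWDevelopingMapObservableToSLETypeLadderCarvedReductionSqueezeFinalA.lean`.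

`SqueezeLimit.final_pair`: from the limit data `Λ`, its outer data `Θ` (`SqueezeLimit.outer`) and
the D-level constants of the inner contract (parameter modulus `s`, radius `rs ≤ η/6`), for every
`ε' > 0`: the outer approximant `E_{n₀}` (frame `frameDatum` over the outer sequence of `Θ`, `n₀`
from `ε'` and the radii `r₁, R₁` of the inner contract
`Squeeze.stub_carvedReduction_innerApproximant` at `ρw := ρ/128`), the inner approximant `M'`, the
uniformizer `φE`, restriction map `Φ`, derivative `d` with `1 - ε' < d ^ (5/8)`, and the
domain-dependent clauses of STAGE 2′: hull subdomain, `(C2)`, flatness at `ρ/128`, boxes, `(MD)`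
(`eventually_translate_mem_MD`), `(MU_F)` (`eventually_not_mem_MU` + eventual carving of the
compact core), and the REACH clause (R) for `E_{n₀}` (`reach_transfer_level` at every large
level: the good component of `E ∖ Zc_{n₀}` survives in `E_{n₀}`).
Registered carrier: `stub_carvedReduction_finalA`.
-/

noncomputable section

open scoped Topology
open Filter Set Metric MeasureTheory
open Literature.Probability.LatticeModels (HexVertex hexGraph hexCenter triEmbed Site)
open Literature.Probability.RandomPlanarGeometry
open Literature.Probability.RandomPlanarGeometry.SAW
open UpperHalfPlane (upperHalfPlaneSet)

namespace Summit.CriticalPhenomena.SAWScalingLimit.Theorems.ObservableToSLE.TypeLadder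

open Summit.CriticalPhenomena.SAWScalingLimit.Theorems.ObservableToSLER.BridgeGate
open Summit.CriticalPhenomena.SAWScalingLimit.Theorems.ObservableToSLER.Squeeze (stub_carvedReduction_innerApproximant)

/-- **THE FINAL PAIR AND ITS CLAUSES**; see the module docstring. -/
theorem SqueezeLimit.final_pair {D : DobrushinDomain} {a b : ℝ → HexVertex} {δ : ℕ → ℝ} {S T : ℕ → ℕ → Set HexVertex}
    {n n' : ℕ → ℕ} {q q' : ℕ → HexVertex} {κ : ℕ → ℕ} {ρ R : ℝ} {N : ℕ}
    (Λ : SqueezeLimit D a b δ S T n n' q q' κ ρ R N) {rs : ℝ} (Θ : SqueezeOuter Λ rs) {η sP : ℝ} (hη : 0 < η)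
    (hηd : η ≤ dist (D.pt 0) (D.pt 1)) (hrs : 0 < rs) (hrsη : rs ≤ η / 6) (hRrs : 2 * R < rs) (hsP : 0 < sP)
    (hab : D.mark 0 + sP < D.mark 1 - sP) (hba : D.mark 1 + sP < D.mark 0 + 1 - sP)
    (H1 : ∀ i : Fin 2, ∀ t : ℝ, |t - D.mark i| ≤ sP → dist (D.boundary t) (D.pt i) < η / 3)
    (H2 : ∀ i : Fin 2, ∀ t : ℝ, dist (D.boundary t) (D.pt i) ≤ 2 * rs → ∃ nn : ℤ, |t - D.mark i - nn| < sP)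
    {ε' : ℝ} (hε' : 0 < ε') :
    ∃ (Ef M : DobrushinDomain) (φE : ConformalEquiv upperHalfPlaneSet Ef.carrier)
      (Φ : ConformalEquiv (upperHalfPlaneSet \ φE.pullbackHull M) upperHalfPlaneSet) (d : ℝ),
      Ef.pt 0 = Λ.P₀ ∧ Ef.pt 1 = Λ.P₁ ∧ Ef.IsHullSubdomain M ∧
      (∀ t : ℝ, dist (M.boundary t + Λ.τ) (D.boundary t) ≤ η) ∧ dist (M.pt 0 + Λ.τ) (D.pt 0) ≤ η ∧ dist (M.pt 1 + Λ.τ) (D.pt 1) ≤ η ∧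
      (∀ i, Ef.carrier ∩ ball (Ef.pt i) (ρ / 128) = {z : ℂ | (Ef.pt i).im < z.im} ∩ ball (Ef.pt i) (ρ / 128)) ∧
      (∀ i (z : ℂ), |z.re - (Ef.pt i).re| ≤ ρ / 64 → (Ef.pt i).im - ρ / 128 ≤ z.im → z.im ≤ (Ef.pt i).im → z ∉ Ef.carrier) ∧
      Ef.IsChordalUniformizing φE ∧ IsRestrictionMap (φE.pullbackHull M) Φ ∧ HasRestrictionDeriv (φE.pullbackHull M) Φ d ∧
      1 - ε' < d ^ ((5 : ℝ) / 8) ∧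
      (∀ᶠ j in atTop, ∀ z : ℂ, (z ∈ M.carrier ∨ ∃ i, dist z (Ef.pt i) ≤ 2 * (ρ / 64)) →
        z + ((δ (κ j) : ℝ) : ℂ) * triEmbed (Λ.x j) ∈ D.carrier) ∧
      (∀ᶠ j in atTop, ∀ v : HexVertex, ((δ (κ j) : ℝ) : ℂ) * hexCenter v - ((δ (κ j) : ℝ) : ℂ) * triEmbed (Λ.x j) ∈ M.carrier →
        (∀ i, ρ / 128 ≤ dist (((δ (κ j) : ℝ) : ℂ) * hexCenter v - ((δ (κ j) : ℝ) : ℂ) * triEmbed (Λ.x j)) (Ef.pt i)) →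
          v ∉ S (κ j) (n (κ j)) ∪ T (κ j) (n' (κ j))) ∧
      (∀ᶠ j in atTop, ∀ (w : HexVertex) (π : (hexDomainGraph D.carrier (δ (κ j))).Walk (q (κ j)) w),
        (∀ y ∈ π.support, y ∉ S (κ j) (n (κ j)) ∪ T (κ j) (n' (κ j))) → ∀ y ∈ π.support,
          ((δ (κ j) : ℝ) : ℂ) * hexCenter y - ((δ (κ j) : ℝ) : ℂ) * triEmbed (Λ.x j) ∈ Ef.carrier ∧
          closedBall (((δ (κ j) : ℝ) : ℂ) * hexCenter y - ((δ (κ j) : ℝ) : ℂ) * triEmbed (Λ.x j)) (25 * δ (κ j)) ⊆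
            Ef.carrier ∪ ⋃ i, {z : ℂ | |z.re - (Ef.pt i).re| ≤ ρ / 64 ∧ (Ef.pt i).im - 30 * δ (κ j) ≤ z.im ∧ z.im ≤ (Ef.pt i).im}) := by
  have hρ := Λ.hρ
  have hs0 : Tendsto (fun j => δ (κ j)) atTop (𝓝 0) := Λ.s0.mono_right nhdsWithin_le_nhds
  have hEpt : ∀ i : Fin 2, Λ.E.pt i = Λ.Pv i := Fin.forall_fin_two.2 ⟨Λ.hEpt0, Λ.hEpt1⟩
  have hPα' : ∀ i : Fin 2, dist (Λ.Pv i) (D.pt i - Λ.τ) ≤ R := by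
    have h0 := Λ.hPα 0; have h1 := Λ.hPα 1
    simp only [Matrix.cons_val_zero, Matrix.cons_val_one] at h0 h1
    exact Fin.forall_fin_two.2 ⟨h0, h1⟩
  -- the bulk of the contract is `Λ.Ω`
  have eΩ : connectedComponentIn (((fun z => z - Λ.τ) '' D.carrier) \ ⋃ k, Λ.Kf k) Λ.b₀ = Λ.Ω := by
    rw [Λ.iUnion_Kf]; rfl
  set A : Set ℂ := closure (upperHalfPlaneSet \ Θ.φ.symm '' Λ.Ω) with hA
  have hAne : A.Nonempty := by
    obtain ⟨z, hzE, hzΩ⟩ := Θ.hEΩ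
    refine ⟨Θ.φ.symm z, subset_closure ⟨Θ.φ.symm_mapsTo hzE, fun h => hzΩ ?_⟩⟩
    have := (mem_symm_image_iff Θ.hΩE (Θ.φ.symm_mapsTo hzE)).1 h
    rwa [Θ.φ.apply_symm_apply hzE] at this
  -- the inner contract, radii
  have hwin' : ∀ i : Fin 2, {z : ℂ | (Λ.E.pt i).im < z.im} ∩ ball (Λ.E.pt i) (ρ / 128) ⊆
      connectedComponentIn (((fun z => z - Λ.τ) '' D.carrier) \ ⋃ k, Λ.Kf k) Λ.b₀ := by
    intro i z hz; rw [eΩ]; rw [hEpt i] at hz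
    exact Θ.hwin i ⟨hz.1, ball_subset_ball (by linarith) hz.2⟩
  obtain ⟨r₁, hr₁, R₁, hcontract⟩ := stub_carvedReduction_innerApproximant D Λ.E Λ.τ Λ.b₀ Θ.φ (N + N) Λ.Kf (ρ / 128) rs η sP
    Θ.hφ (by positivity) hrs hη hrsη hηd hsP hab hba H1 H2 Λ.hEflat Θ.hKf Θ.hKfball
    (fun i => by rw [hEpt i]; exact mem_ball.2 (by linarith [hPα' i])) hwin' (by rw [eΩ]; exact Θ.hΩE)
    (by rw [eΩ]; exact Θ.hEΩ) (by rw [eΩ]; exact Θ.hfar) (by rw [eΩ]; exact Θ.hΩcc) (ρ / 128) (by positivity)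
  -- the frame
  obtain ⟨δ₀, hδ₀, θ, hθ, n₀, hframe⟩ := frameDatum Λ.E Θ.φ A Θ.En Θ.hEn Θ.hφ Θ.hAstar hAne Θ.hmono Θ.hsub Θ.hker
    (ε' := ε') (r' := r₁) R₁ hε' hr₁
  obtain ⟨M, -, hHull, hMΩ, -, ⟨Kc, hKc, hKcΩ, hKcM⟩, hAM, hMt, hC2, hp0, hp1⟩ := hcontract r₁ R₁ δ₀ θ hr₁ le_rfl le_rfl hδ₀ hθ
  rw [eΩ] at hMΩ hKcΩ hAM hMt
  obtain ⟨φE, Ψ, d, hunif, hsubM, hΨ, hd, hd58⟩ := hframe n₀ le_rfl M hHull (hMΩ.trans (Θ.hΩEn n₀)) hAM hMt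
  -- the final domain
  have hEfE : (Θ.En n₀).carrier ⊆ Λ.E.carrier := (Θ.hEn n₀).carrier_subset
  have hEfpt : ∀ i : Fin 2, (Θ.En n₀).pt i = Λ.Pv i :=
    Fin.forall_fin_two.2 ⟨(Θ.hEn n₀).2.1.trans (hEpt 0), (Θ.hEn n₀).2.2.1.trans (hEpt 1)⟩
  refine ⟨Θ.En n₀, M, φE, Ψ, d, hEfpt 0, hEfpt 1, hsubM, hC2, hp0, hp1, fun i => ?_, fun i z h1 h2 h3 hz => ?_, hunif, hΨ, hd, hd58,
    ?_, ?_, ?_⟩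
  · -- flatness at `ρ/128`
    rw [hEfpt i]
    refine Subset.antisymm (fun z hz => ⟨?_, hz.2⟩) fun z hz => ⟨Θ.hΩEn n₀ (Θ.hwin i ⟨hz.1, ball_subset_ball (by linarith) hz.2⟩), hz.2⟩
    have h1 : z ∈ Λ.E.carrier ∩ ball (Λ.E.pt i) (ρ / 128) := ⟨hEfE hz.1, by rw [hEpt i]; exact hz.2⟩
    rw [Λ.hEflat i, hEpt i] at h1
    exact h1.1
  · -- boxes
    rw [hEfpt i, ← hEpt i] at h1 h2 h3
    exact Λ.hEbox i z h1 h2 h3 (hEfE hz)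
  · -- (MD)
    have hKcM' : closure M.carrier ⊆ Kc ∪ ⋃ i : Fin 2, ball ((Θ.En n₀).pt i) (ρ / 128) := by
      refine hKcM.trans (union_subset_union_right _ (iUnion_mono fun i => ?_)); rw [hEfpt i, hEpt i]
    have hballs : ∀ᶠ j in atTop, ∀ i : Fin 2, closedBall ((Θ.En n₀).pt i + ((δ (κ j) : ℝ) : ℂ) * triEmbed (Λ.x j)) (ρ / 2) ⊆ D.carrier := by
      filter_upwards [Λ.hballs] with j hj
      refine Fin.forall_fin_two.2 ⟨?_, ?_⟩
      · rw [hEfpt 0]; exact hj.1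
      · rw [hEfpt 1]; exact hj.2
    exact eventually_translate_mem_MD (Ω₀ := D.carrier) (P := fun i => (Θ.En n₀).pt i) D.isOpen hKc
      (fun z hz => by obtain ⟨w, hw, rfl⟩ := Θ.hΩD (hKcΩ hz); simpa using hw) hKcM' Λ.hτ (ρ₂ := ρ / 2) (ρg := 2 * (ρ / 64))
      (by linarith) (by linarith) hballs
  · -- (MU_F)
    have hKcM' : closure M.carrier ⊆ Kc ∪ ⋃ i : Fin 2, ball ((Θ.En n₀).pt i) (ρ / 128) := by
      refine hKcM.trans (union_subset_union_right _ (iUnion_mono fun i => ?_)); rw [hEfpt i, hEpt i]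
    have hcarve := Λ.hcarve Kc hKc
      (fun i => disjoint_left.2 fun z hz hzc => disjoint_left.1 Θ.hΩX (hKcΩ hz) (Or.inl (mem_iUnion.2 ⟨i, hzc⟩)))
      (fun i => disjoint_left.2 fun z hz hzc => disjoint_left.1 Θ.hΩX (hKcΩ hz) (Or.inr (mem_iUnion.2 ⟨i, hzc⟩)))
    exact eventually_not_mem_MU (s := fun j => δ (κ j)) (U := fun j => S (κ j) (n (κ j)) ∪ T (κ j) (n' (κ j)))
      (P := fun i => (Θ.En n₀).pt i) hKcM' le_rfl hcarve
  · -- (R)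
    have hbox : ∀ (i : Fin 2) (z : ℂ), z ∈ gateRect (Λ.Pv i) ρ → z ∉ Λ.E.carrier := by
      intro i z hz; have := Λ.hEbox i z; rw [hEpt i] at this; exact this hz.1 hz.2.1 hz.2.2
    have hqcl : ∀ j, ((δ (κ j) : ℝ) : ℂ) * hexCenter (q (κ j)) ∈ closure D.carrier := fun j =>
      subset_closure (embMeshDomain_subset hexGraph hexCenter D.carrier (δ (κ j)) (Λ.hqdom j))
    -- the pinned gate vertex is eventually in the bulk
    have hqΩ : ∀ᶠ j in atTop, ((δ (κ j) : ℝ) : ℂ) * hexCenter (q (κ j)) - ((δ (κ j) : ℝ) : ℂ) * triEmbed (Λ.x j) ∈ Λ.Ω := by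
      have h1 : ∀ᶠ j in atTop, dist (((δ (κ j) : ℝ) : ℂ) * hexCenter (q (κ j)) - ((δ (κ j) : ℝ) : ℂ) * triEmbed (Λ.x j)) Λ.P₀ < ρ / 2 :=
        (tendsto_iff_dist_tendsto_zero.1 Λ.hconvq).eventually (gt_mem_nhds (by positivity))
      filter_upwards [h1] with j hj
      refine Θ.hwin 0 ⟨?_, mem_ball.2 hj⟩
      have := Λ.habove j
      rw [pinnedGate_eq _ _ (Λ.hq2 j)] at this
      exact this
    have hup : ∀ᶠ j in atTop, ∀ v : HexVertex, v ∉ S (κ j) (n (κ j)) ∪ T (κ j) (n' (κ j)) → ∀ i : Fin 2,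
        dist (((δ (κ j) : ℝ) : ℂ) * hexCenter v - ((δ (κ j) : ℝ) : ℂ) * triEmbed (Λ.x j)) (Λ.Pv i) < ρ / 2 →
          (Λ.Pv i).im < (((δ (κ j) : ℝ) : ℂ) * hexCenter v - ((δ (κ j) : ℝ) : ℂ) * triEmbed (Λ.x j)).im := by
      filter_upwards [Λ.hup 0, Λ.hup 1] with j h0 h1 v hv
      exact Fin.forall_fin_two.2 ⟨fun hd => h0 v (mem_ball.2 hd) hv, fun hd => h1 v (mem_ball.2 hd) hv⟩
    have hER := Λ.hER
    simp_rw [hEpt] at hER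
    filter_upwards [hER, hqΩ, hup, Θ.hZfar n₀, Θ.htz25 n₀] with j hRj hqj hupj hZj htj w π hπ y hy
    have key := reach_transfer_level (E := Λ.E.carrier) (Zc := Θ.Zc n₀) (Ω₀ := D.carrier) (P := Λ.Pv) (b₀ := Λ.b₀)
      (τj := ((δ (κ j) : ℝ) : ℂ) * triEmbed (Λ.x j)) (ρ := ρ) (t := Θ.tz n₀) (s := δ (κ j))
      (U := S (κ j) (n (κ j)) ∪ T (κ j) (n' (κ j))) π (Λ.spos j) hρ htj (Θ.htz n₀).2 (Θ.hV n₀)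
      (fun i => Θ.hΩG n₀ (Θ.hbase i)) (Θ.hΩG n₀ hqj) hπ (hRj w π hπ) hupj
      (fun y' hy' z hz => hZj y' (hπ y' hy') (smul_hexCenter_mem_closure_of_walk π (hqcl j) y' hy') z hz) hbox y hy
    refine ⟨Θ.hGEn n₀ key.1, fun z hz => ?_⟩
    rcases (hRj w π hπ y hy).2 hz with hzE | hzS
    · exact Or.inl (Θ.hGEn n₀ (key.2 ⟨hz, hzE⟩))
    · refine Or.inr ?_
      simp_rw [hEfpt]
      exact hzS

/-- **Registered carrier `stub_carvedReduction_finalA`** (crux item stmt-CriticalPhenomena-10472, stub T-A′₂F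
`stub_carvedReduction_squeezeGeometry_domainsCoreF`, piece FINAL-A): the outer data of a `SqueezeLimit`
keeps the bulk inside every outer approximant. -/
theorem stub_carvedReduction_finalA {D : DobrushinDomain} {a b : ℝ → HexVertex} {δ : ℕ → ℝ} {S T : ℕ → ℕ → Set HexVertex}
    {n n' : ℕ → ℕ} {q q' : ℕ → HexVertex} {κ : ℕ → ℕ} {ρ R : ℝ} {N : ℕ}
    (Λ : SqueezeLimit D a b δ S T n n' q q' κ ρ R N) {rs : ℝ} (Θ : SqueezeOuter Λ rs) : ∀ m, Λ.Ω ⊆ (Θ.En m).carrier :=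
  Θ.hΩEn

end Summit.CriticalPhenomena.SAWScalingLimit.Theorems.ObservableToSLE.TypeLadder

end
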